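import Summits.QuantumFields.YangMills.Theorems.F4SubCurvatureDoorRationalToGeneralDiagonalConeSupport
import Summits.QuantumFields.YangMills.Theorems.F4SubCurvatureDoorMirrorContinuation
import Mathlib
import HarnessLib

/-!
# Polyhedral cone support of the Laplace–Fourier measure: `supp μ̂ ⊆ {E ≥ ‖q⃗‖₁/√3}`, aperture `1/√3`

Sub-problem `YangMills`, crux ⟨stmt-QuantumFields-23125⟩ `RationalToGeneral.GlobalShortRootRigidity`, rung S1 «FORWARD-CONE SUPPORT»
(`Cruxes/RationalToGeneral/Lines/forward_cone_rungs.lean`).  Companion of ✓`…RationalToGeneralDiagonalConeSupport`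
(`measure_lt_abs_diag_eq_zero`: `μ {E < |q₁+q₂+q₃|/√3} = 0` for every Laplace–Fourier measure `μ` of a C3-class kernel).

* `isLF_map` — TRANSPORT: if `K ∘ R = K` for an isometry `R` of `ℝ⁴` acting as `(t, z⃗) ↦ (t, S z⃗)`, then `(E, q⃗) ↦ (E, S q⃗)`
  pushes Laplace–Fourier measures of `K` to Laplace–Fourier measures of `K`;
* `measure_lt_abs_diag_flip_eq_zero` — the coordinate mirrors `q_j ↦ −q_j` are signed permutations (✓`isSignedPerm_reflection_single`),
  so the diagonal cone theorem holds for all four diagonals `(±1,±1,±1)/√3`;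
* `measure_lt_l1_eq_zero` — ★ the POLYHEDRAL CONE: `μ {E < (|q₁|+|q₂|+|q₃|)/√3} = 0` (the four diagonal cones intersect in
  `{E ≥ ‖q⃗‖₁/√3}`; `abs_add_abs_add_abs_le_max`);
* `aperture_inv_sqrt_three` — the round consequence `μ {E < ‖q⃗‖/√3} = 0`, i.e. the input shape of `ApertureBootstrap` with
  `κ = 1/√3 ≈ 0.577` (against the universal `κ₀ = c_frame/192` of ✓`initialAperture_holds`), exact on the 8 diagonals;
* `measure_lt_abs_signed_sum_eq_zero` + ★★`diagonalGain_unfolded` — the typed rung R-S1e «DIAGONAL GAIN» (`forward_cone_rungs.lean` :151,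
  body unfolded; the by-name wrapper is the companion file `…DiagonalGain`): with the diagonal cones in SUPPORT form the gain along the eight
  diagonals holds for EVERY `κ' < 1`, without the aperture hypothesis — `∫ e^{−tE + κ't|∑±qⱼ|/√3} dμ ≤ ∫ e^{−(1−κ')tE} dμ = K((1−κ')t e₀)`.

No `def` is introduced (proof lane).  HONEST LABEL: a rung toward S1 (`ForwardConeSupport` = aperture `1`), not S1; the YM mass gap
is NOT proved.
-/

noncomputable section

open MeasureTheory Filter Topology Set
open scoped BigOperators ENNReal NNReal RealInnerProductSpace

namespace Summit.QuantumFields.YangMills.Theorems.F4SubCurvatureDoorPolyhedralConeSupport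

open Summit.QuantumFields.YangMills.Cruxes.OSLegsAtWeakCouplingC.Sketch (IsSignedPerm)
open Summit.QuantumFields.YangMills.Theorems.F4SubCurvatureDoorLaplaceFourierRegistered (E4 E3 InClass timeSpace IsLF)
open Summit.QuantumFields.YangMills.Theorems.F4SubCurvatureDoorLaplacianMultiplierRegistered
  (timeSpace_apply_zero timeSpace_apply_succ)
open Summit.QuantumFields.YangMills.Theorems.F4SubCurvatureDoorGlobalReduction
  (reflection_single_apply isSignedPerm_reflection_single)
open Summit.QuantumFields.YangMills.Theorems.F4SubCurvatureDoorDiagonalConeSupport (measure_lt_abs_diag_eq_zero)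

/-! ## 1. Transport of Laplace–Fourier measures under spatial symmetries -/

/-- ★ TRANSPORT.  If the isometry `R` of `ℝ⁴` acts as `(t, z⃗) ↦ (t, S z⃗)` and `K ∘ R = K`, then the push-forward of a
Laplace–Fourier measure of `K` under `(E, q⃗) ↦ (E, S q⃗)` is again a Laplace–Fourier measure of `K`. -/
theorem isLF_map {K : E4 → ℝ} {μ : Measure (ℝ × E3)} (hμ : IsLF K μ) (S : E3 ≃ₗᵢ[ℝ] E3) (R : E4 ≃ₗᵢ[ℝ] E4)
    (hRS : ∀ (t : ℝ) (z : E3), R (timeSpace t z) = timeSpace t (S z)) (hK : ∀ x, K (R x) = K x) :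
    IsLF K (μ.map fun p : ℝ × E3 => (p.1, S p.2)) := by
  have hm : Measurable fun p : ℝ × E3 => (p.1, S p.2) :=
    measurable_fst.prodMk (S.continuous.measurable.comp measurable_snd)
  obtain ⟨h0, hint, hrep⟩ := hμ
  refine ⟨?_, fun t ht => ?_, fun t z ht => ?_⟩
  · rw [Measure.map_apply hm (measurableSet_Iio.prod MeasurableSet.univ)]
    have : (fun p : ℝ × E3 => (p.1, S p.2)) ⁻¹' (Iio (0 : ℝ) ×ˢ (univ : Set E3)) = Iio 0 ×ˢ univ := by
      ext p; simp
    rw [this]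
    exact h0
  · rw [integrable_map_measure (by fun_prop) hm.aemeasurable]
    exact hint t ht
  · have h1 : timeSpace t z = R (timeSpace t (S.symm z)) := by
      rw [hRS, LinearIsometryEquiv.apply_symm_apply]
    have hc : Continuous fun p : ℝ × E3 => Real.exp (-(t * p.1)) * Real.cos ⟪p.2, z⟫ := by fun_prop
    rw [h1, hK, hrep t _ ht, integral_map hm.aemeasurable hc.aestronglyMeasurable]
    refine integral_congr_ae (Eventually.of_forall fun p => ?_)
    simp only
    rw [LinearIsometryEquiv.inner_map_eq_flip]

/-! ## 2. The four diagonals -/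

/-- The diagonal cone theorem for the mirrored diagonals: `μ {E < |∑ᵢ ±qᵢ|/√3} = 0` with the sign flipped at one coordinate `j`
(transport by the coordinate mirror `x_{j+1} ↦ −x_{j+1}`, a signed permutation). -/
theorem measure_lt_abs_diag_flip_eq_zero (K : E4 → ℝ) (μ : Measure (ℝ × E3)) (hK : InClass K) (hμ : IsLF K μ) (j : Fin 3) :
    μ {p | p.1 < |∑ i : Fin 3, (if i = j then -p.2 i else p.2 i)| / Real.sqrt 3} = 0 := by
  -- the spatial mirror and its 4-D lift
  obtain ⟨S, hS⟩ : ∃ S : E3 ≃ₗᵢ[ℝ] E3, ∀ (z : E3) (i : Fin 3), S z i = if i = j then -z i else z i :=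
    ⟨LinearIsometryEquiv.piLpCongrRight 2 fun i : Fin 3 =>
        if i = j then LinearIsometryEquiv.neg ℝ else LinearIsometryEquiv.refl ℝ ℝ,
      fun z i => by
        simp only [LinearIsometryEquiv.piLpCongrRight_apply, PiLp.toLp_apply]
        split_ifs <;> rfl⟩
  set R : E4 ≃ₗᵢ[ℝ] E4 := (ℝ ∙ (EuclideanSpace.single j.succ (1 : ℝ) : E4))ᗮ.reflection with hRdef
  have hR : ∀ (x : E4) (i : Fin 4), R x i = if i = j.succ then -x i else x i := fun x i => by
    rw [hRdef, reflection_single_apply]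
  have hRS : ∀ (t : ℝ) (z : E3), R (timeSpace t z) = timeSpace t (S z) := by
    intro t z
    ext i
    cases i using Fin.cases with
    | zero => rw [hR, timeSpace_apply_zero, timeSpace_apply_zero, if_neg (Fin.succ_ne_zero j).symm]
    | succ k =>
      rw [hR, timeSpace_apply_succ, timeSpace_apply_succ, hS]
      by_cases hk : k = j
      · subst hk; simp
      · rw [if_neg hk, if_neg (fun h => hk (Fin.succ_inj.mp h))]
  have hKR : ∀ x, K (R x) = K x := hK.2.2.1 R (by rw [hRdef]; exact isSignedPerm_reflection_single j.succ)
  have hLF := isLF_map hμ S R hRS hKR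
  have h := measure_lt_abs_diag_eq_zero K _ hK hLF
  have hm : Measurable fun p : ℝ × E3 => (p.1, S p.2) :=
    measurable_fst.prodMk (S.continuous.measurable.comp measurable_snd)
  have hset : MeasurableSet {p : ℝ × E3 | p.1 < |p.2 0 + p.2 1 + p.2 2| / Real.sqrt 3} :=
    (isOpen_lt continuous_fst (by fun_prop)).measurableSet
  rw [Measure.map_apply hm hset] at h
  convert h using 2
  ext p
  simp only [Fin.sum_univ_three, Set.mem_setOf_eq, Set.mem_preimage, hS]

/-- `|a| + |b| + |c| ≤ max (|a+b+c|, |−a+b+c|, |a−b+c|, |a+b−c|)` (in fact `=`). [folklore] -/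
theorem abs_add_abs_add_abs_le_max (a b c : ℝ) :
    |a| + |b| + |c| ≤ max (max |a + b + c| |-a + b + c|) (max |a - b + c| |a + b - c|) := by
  have h1 : |a + b + c| ≤ max (max |a + b + c| |-a + b + c|) (max |a - b + c| |a + b - c|) :=
    le_max_of_le_left (le_max_left _ _)
  have h2 : |-a + b + c| ≤ max (max |a + b + c| |-a + b + c|) (max |a - b + c| |a + b - c|) :=
    le_max_of_le_left (le_max_right _ _)
  have h3 : |a - b + c| ≤ max (max |a + b + c| |-a + b + c|) (max |a - b + c| |a + b - c|) :=
    le_max_of_le_right (le_max_left _ _)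
  have h4 : |a + b - c| ≤ max (max |a + b + c| |-a + b + c|) (max |a - b + c| |a + b - c|) :=
    le_max_of_le_right (le_max_right _ _)
  have g1 := le_abs_self (a + b + c); have g1' := neg_le_abs (a + b + c)
  have g2 := le_abs_self (-a + b + c); have g2' := neg_le_abs (-a + b + c)
  have g3 := le_abs_self (a - b + c); have g3' := neg_le_abs (a - b + c)
  have g4 := le_abs_self (a + b - c); have g4' := neg_le_abs (a + b - c)
  rcases abs_cases a with ⟨ha, _⟩ | ⟨ha, _⟩ <;> rcases abs_cases b with ⟨hb, _⟩ | ⟨hb, _⟩ <;>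
    rcases abs_cases c with ⟨hc, _⟩ | ⟨hc, _⟩ <;> rw [ha, hb, hc] <;> linarith

/-! ## 3. The polyhedral cone and the round aperture `1/√3` -/

/-- ★★ **POLYHEDRAL CONE SUPPORT.**  For every kernel `K` of the C3 class and every Laplace–Fourier measure `μ` of `K`:
`μ {E < (|q₁|+|q₂|+|q₃|)/√3} = 0` — the spectral measure is carried by `{E ≥ ‖q⃗‖₁/√3}`, the intersection of the four diagonal
cones `{E ≥ |⟪q⃗, (±1,±1,±1)/√3⟫|}`. -/
theorem measure_lt_l1_eq_zero (K : E4 → ℝ) (μ : Measure (ℝ × E3)) (hK : InClass K) (hμ : IsLF K μ) :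
    μ {p | p.1 < (|p.2 0| + |p.2 1| + |p.2 2|) / Real.sqrt 3} = 0 := by
  have h0 := measure_lt_abs_diag_eq_zero K μ hK hμ
  have h1 : μ {p | p.1 < |-p.2 0 + p.2 1 + p.2 2| / Real.sqrt 3} = 0 := by
    convert measure_lt_abs_diag_flip_eq_zero K μ hK hμ 0 using 2
    ext p
    simp only [Set.mem_setOf_eq, Fin.sum_univ_three, ite_true,
      if_neg (show (1 : Fin 3) ≠ 0 by decide), if_neg (show (2 : Fin 3) ≠ 0 by decide)]
  have h2 : μ {p | p.1 < |p.2 0 - p.2 1 + p.2 2| / Real.sqrt 3} = 0 := by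
    convert measure_lt_abs_diag_flip_eq_zero K μ hK hμ 1 using 2
    ext p
    simp only [Set.mem_setOf_eq, Fin.sum_univ_three, ite_true,
      if_neg (show (0 : Fin 3) ≠ 1 by decide), if_neg (show (2 : Fin 3) ≠ 1 by decide), ← sub_eq_add_neg]
  have h3 : μ {p | p.1 < |p.2 0 + p.2 1 - p.2 2| / Real.sqrt 3} = 0 := by
    convert measure_lt_abs_diag_flip_eq_zero K μ hK hμ 2 using 2
    ext p
    simp only [Set.mem_setOf_eq, Fin.sum_univ_three, ite_true,
      if_neg (show (0 : Fin 3) ≠ 2 by decide), if_neg (show (1 : Fin 3) ≠ 2 by decide), ← sub_eq_add_neg]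
  have hs3 : 0 < Real.sqrt 3 := Real.sqrt_pos.mpr (by norm_num)
  apply measure_mono_null _ (measure_union_null (measure_union_null h0 h1) (measure_union_null h2 h3))
  intro p hp
  simp only [Set.mem_setOf_eq] at hp
  simp only [Set.mem_union, Set.mem_setOf_eq]
  have key := abs_add_abs_add_abs_le_max (p.2 0) (p.2 1) (p.2 2)
  have hlt : p.1 * Real.sqrt 3 < |p.2 0| + |p.2 1| + |p.2 2| := by
    rwa [lt_div_iff₀ hs3] at hp
  rcases le_max_iff.mp key with h | h <;> rcases le_max_iff.mp h with h' | h'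
  · left; left; rw [lt_div_iff₀ hs3]; linarith
  · left; right; rw [lt_div_iff₀ hs3]; linarith
  · right; left; rw [lt_div_iff₀ hs3]; linarith
  · right; right; rw [lt_div_iff₀ hs3]; linarith

/-- ★ **APERTURE `1/√3`.**  For every kernel `K` of the C3 class and every Laplace–Fourier measure `μ` of `K`:
`μ {E < ‖q⃗‖/√3} = 0` — the input shape of `ApertureBootstrap` with `κ = (√3)⁻¹`. -/
theorem aperture_inv_sqrt_three (K : E4 → ℝ) (μ : Measure (ℝ × E3)) (hK : InClass K) (hμ : IsLF K μ) :
    μ {p | p.1 < (Real.sqrt 3)⁻¹ * ‖p.2‖} = 0 := by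
  have hs3 : 0 < Real.sqrt 3 := Real.sqrt_pos.mpr (by norm_num)
  refine measure_mono_null (fun p hp => ?_) (measure_lt_l1_eq_zero K μ hK hμ)
  simp only [Set.mem_setOf_eq] at hp ⊢
  -- `‖q⃗‖ ≤ ‖q⃗‖₁` (cf. `Literature…LegendrianDarboux.DarbouxData.norm_le_sum_abs`, not imported for one line)
  have hl1 : ‖p.2‖ ≤ |p.2 0| + |p.2 1| + |p.2 2| := by
    rw [EuclideanSpace.norm_eq, Fin.sum_univ_three, Real.sqrt_le_left]
    · simp only [Real.norm_eq_abs]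
      nlinarith [abs_nonneg (p.2 0), abs_nonneg (p.2 1), abs_nonneg (p.2 2), sq_abs (p.2 0), sq_abs (p.2 1), sq_abs (p.2 2)]
    · positivity
  calc p.1 < (Real.sqrt 3)⁻¹ * ‖p.2‖ := hp
    _ ≤ (Real.sqrt 3)⁻¹ * (|p.2 0| + |p.2 1| + |p.2 2|) :=
        mul_le_mul_of_nonneg_left hl1 (inv_nonneg.mpr hs3.le)
    _ = (|p.2 0| + |p.2 1| + |p.2 2|) / Real.sqrt 3 := by rw [div_eq_inv_mul]

/-- `ApertureBootstrap` BELOW `1/√3` is free: every `κ < (√3)⁻¹` improves to `κ' = (√3)⁻¹` (so the several-complex-variables bootstrap only has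
to start at `κ = 1/√3`). -/
theorem apertureBootstrap_below_inv_sqrt_three (κ : ℝ) (hκ : κ < (Real.sqrt 3)⁻¹) :
    ∃ κ' : ℝ, κ < κ' ∧ ∀ (K : E4 → ℝ) (μ : Measure (ℝ × E3)), InClass K → IsLF K μ →
      μ {p | p.1 < κ * ‖p.2‖} = 0 → μ {p | p.1 < κ' * ‖p.2‖} = 0 :=
  ⟨(Real.sqrt 3)⁻¹, hκ, fun K μ hK hμ _ => aperture_inv_sqrt_three K μ hK hμ⟩

/-! ## 4. All eight diagonals, and the rung R-S1e «DIAGONAL GAIN» -/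

/-- The diagonal cone theorem for an arbitrary sign pattern `ε ∈ {±1}³`: `μ {E < |∑ εⱼ qⱼ|/√3} = 0`
(`|∑ εⱼ qⱼ| ≤ ‖q⃗‖₁` and the polyhedral cone). -/
theorem measure_lt_abs_signed_sum_eq_zero (K : E4 → ℝ) (μ : Measure (ℝ × E3)) (hK : InClass K) (hμ : IsLF K μ)
    (ε : Fin 3 → ℝ) (hε : ∀ j, ε j = 1 ∨ ε j = -1) :
    μ {p | p.1 < |∑ j, ε j * p.2 j| / Real.sqrt 3} = 0 := by
  have hs3 : 0 < Real.sqrt 3 := Real.sqrt_pos.mpr (by norm_num)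
  have habs : ∀ j, |ε j| = 1 := fun j => by rcases hε j with h | h <;> simp [h]
  refine measure_mono_null (fun p hp => ?_) (measure_lt_l1_eq_zero K μ hK hμ)
  simp only [Set.mem_setOf_eq] at hp ⊢
  have htri : |∑ j, ε j * p.2 j| ≤ |p.2 0| + |p.2 1| + |p.2 2| := by
    calc |∑ j, ε j * p.2 j| ≤ ∑ j, |ε j * p.2 j| := Finset.abs_sum_le_sum_abs _ _
      _ = |p.2 0| + |p.2 1| + |p.2 2| := by simp only [Fin.sum_univ_three, abs_mul, habs, one_mul]
  exact lt_of_lt_of_le hp (div_le_div_of_nonneg_right htri hs3.le)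

/-- ★★ **RUNG R-S1e «DIAGONAL GAIN»** — the body of `DiagonalGain` (`Cruxes/RationalToGeneral/Lines/forward_cone_rungs.lean` :151), UNFOLDED,
and in fact WITHOUT its aperture hypothesis and with every `κ' < 1`: for `0 < κ < 1`, with `κ' = (1+κ)/2`, `c = (1−κ)/2`, `C₀ = 1`, every class
kernel `K` with Laplace–Fourier measure `μ` has, for all sign patterns and all `t > 0`,
`∫ e^{−tE + κ' t |∑ ±qⱼ|/√3} dμ ≤ K((c t) e₀)` — because `μ`-a.e. `|∑ ±qⱼ|/√3 ≤ E` (`measure_lt_abs_signed_sum_eq_zero`), so the integrand is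
`≤ e^{−(1−κ') t E}`, whose integral IS `K((1−κ')t e₀)` by the Laplace–Fourier representation at `z⃗ = 0`. -/
theorem diagonalGain_unfolded :
    ∀ κ : ℝ, 0 < κ → κ < 1 → ∃ κ' c C₀ : ℝ, κ < κ' ∧ 0 < c ∧ 0 < C₀ ∧
      ∀ (K : E4 → ℝ) (μ : Measure (ℝ × E3)), InClass K → IsLF K μ → μ {p | p.1 < κ * ‖p.2‖} = 0 →
        ∀ (sgn : Fin 3 → Bool) (t : ℝ), 0 < t →
          Integrable (fun p : ℝ × E3 =>
            Real.exp (-(t * p.1) + κ' * t * |∑ j, (if sgn j then (1 : ℝ) else -1) * p.2 j| / Real.sqrt 3)) μ ∧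
          ∫ p : ℝ × E3, Real.exp (-(t * p.1) + κ' * t * |∑ j, (if sgn j then (1 : ℝ) else -1) * p.2 j| / Real.sqrt 3) ∂μ
            ≤ C₀ * K (timeSpace (c * t) 0) := by
  intro κ hκ hκ1
  refine ⟨(1 + κ) / 2, (1 - κ) / 2, 1, by linarith, by linarith, one_pos, ?_⟩
  intro K μ hK hμ _ sgn t ht
  have ht' : 0 < (1 - κ) / 2 * t := mul_pos (by linarith) ht
  -- a.e. `|∑ ±qⱼ|/√3 ≤ E`
  have hnull := measure_lt_abs_signed_sum_eq_zero K μ hK hμ (fun j => if sgn j then (1 : ℝ) else -1)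
    (fun j => by by_cases h : sgn j <;> simp [h])
  have hae : ∀ᵐ p ∂μ, |∑ j, (if sgn j then (1 : ℝ) else -1) * p.2 j| / Real.sqrt 3 ≤ p.1 := by
    rw [ae_iff]
    simpa only [not_le] using hnull
  -- the dominating Laplace integrand
  have hg : Integrable (fun p : ℝ × E3 => Real.exp (-((1 - κ) / 2 * t * p.1))) μ := hμ.2.1 _ ht'
  have hle : ∀ᵐ p ∂μ, ‖Real.exp (-(t * p.1) + (1 + κ) / 2 * t *
      |∑ j, (if sgn j then (1 : ℝ) else -1) * p.2 j| / Real.sqrt 3)‖ ≤ Real.exp (-((1 - κ) / 2 * t * p.1)) := by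
    filter_upwards [hae] with p hp
    rw [Real.norm_eq_abs, abs_of_pos (Real.exp_pos _)]
    apply Real.exp_le_exp.mpr
    have hkt : 0 ≤ (1 + κ) / 2 * t := by positivity
    have := mul_le_mul_of_nonneg_left hp hkt
    rw [← mul_div_assoc] at this
    nlinarith
  have hmeas : AEStronglyMeasurable (fun p : ℝ × E3 => Real.exp (-(t * p.1) + (1 + κ) / 2 * t *
      |∑ j, (if sgn j then (1 : ℝ) else -1) * p.2 j| / Real.sqrt 3)) μ := by
    have : Continuous (fun p : ℝ × E3 => Real.exp (-(t * p.1) + (1 + κ) / 2 * t *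
        |∑ j, (if sgn j then (1 : ℝ) else -1) * p.2 j| / Real.sqrt 3)) := by
      simp only [Fin.sum_univ_three]
      fun_prop
    exact this.aestronglyMeasurable
  have hf : Integrable (fun p : ℝ × E3 => Real.exp (-(t * p.1) + (1 + κ) / 2 * t *
      |∑ j, (if sgn j then (1 : ℝ) else -1) * p.2 j| / Real.sqrt 3)) μ := hg.mono' hmeas hle
  refine ⟨hf, ?_⟩
  -- `∫ e^{−t'E} dμ = K(t' e₀)`
  have hrep : K (timeSpace ((1 - κ) / 2 * t) 0) = ∫ p, Real.exp (-((1 - κ) / 2 * t * p.1)) ∂μ := by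
    rw [hμ.2.2 _ 0 ht']
    refine integral_congr_ae (Eventually.of_forall fun p => ?_)
    simp
  rw [one_mul, hrep]
  refine integral_mono_ae hf hg ?_
  filter_upwards [hle] with p hp
  rw [Real.norm_eq_abs, abs_of_pos (Real.exp_pos _)] at hp
  exact hp

end Summit.QuantumFields.YangMills.Theorems.F4SubCurvatureDoorPolyhedralConeSupport

end
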